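import Summits.FinalStateConjecture.FinalStateConjecture.Theorems.NecksCertify.Negative.NecksCertifyFalseOfEqualVelocityBinaryWitness

/-!
# `NecksCertify` (crux stmt-FinalStateConjecture-13549, route StarvedNecks) — negative side:
# no coordinate moat between two holes with parallel labels

Prover seat `prover-line-stmt-FinalStateConjecture-13549-c5-0` (continuation lead c5), 2026-08-16.
Sorry-free, axioms `propext`, `Classical.choice`, `Quot.sound`.

The three planned lines of the crux (`Cruxes/NecksCertify/Lines/*.lean`) each carry a stub that, for
EVERY honest `C⁴` input, produces an atlas whose tubes are separated IN COORDINATES by a radius growing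
to infinity along the hole clocks:

* `two-cap-focusing-ledger` / `bargmann-small-late-exterior`: `NeckAtlas` clauses (A9) `Rgᵢ → ∞` and
  (A10) `rⱼ y ≤ Rgⱼ(tⱼ y) + 2 → Rgⱼ'(tⱼ' y) + 2 < rⱼ' y` at flat-late `y` (input labels);
* `order-zero-induction-zone`: `NeckShape.necks_far` `r'ᵢ y ≤ 256 Wᵢ(t'ᵢ y) → 256 Wⱼ(t'ⱼ y) < r'ⱼ y`
  at hole-late `y`, with `Wⱼ ≥ 64 Rgⱼ → ∞` (new rest frames);
* the crux's own `Sm`: S8 + S12 (`false_of_parallel_boosts`, p73407; growth automatic by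
  `excision_tendsto_atTop_of_seamed`, p120139).

`false_of_parallel_timeAxes_of_moat` is the common combinatorial core, stated once over two Poincaré
motions `(Λ, c)`, `(Λ', c')` with PARALLEL, orthochronous time axes `Λ∂₀ = Λ'∂₀`: a "moat" clause
`r y ≤ F (t y) → G (t' y) < r' y` (guarded by lateness of the flat clock `y⁰` and of the hole clock
`t y`) with `F ≥ 0` eventually and `G → ∞` is contradictory.  Witness: the axis `y(s) = c + s·Λ∂₀` of
the first hole — its own radius is `0`, its own clock is `s`, while in the second frame it is the
time-translate `s·∂₀ + Λ'⁻¹(c − c')` of a FIXED point, so its second radius is a constant `K` and its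
second clock is `s + const → ∞`; for late `s` the moat demands `G(s + const) < K` against `G → ∞`.
Corollaries in the exact clause shapes of the lines: `false_of_parallel_labels_of_coordinateDisjoint`
((A9)+(A10), any additive margin `c`), `false_of_parallel_timeAxes_of_necksFar` (multiplicative shape),
and the `FinalStateDecomposition` form `false_of_parallel_labels_of_moat`.

Consequence recorded on the item (line-dead evidence of lead c5): modulo the physics-level hypothesis
`H₀` "some admissible MGHD carries an honest `C⁴` decomposition with two parallel orthochronous labels"
(a threshold / parabolic two-hole recession; not constructible in the tree, Disproof §A), the atlas
stubs of all three lines are false exactly as the crux's S12 is; the recorded repair is the planner's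
restatement C′ (`Cruxes/NecksCertify/Restated.lean`), under which every moat clause is coordinate
geometry of DISTINCT velocities.
-/

noncomputable section

open scoped Manifold ContDiff Topology ENNReal
open Filter Set Literature.Geometry.Lorentzian

namespace Summit.FinalStateConjecture.FinalStateConjecture.Theorems.NecksCertify.Negative

set_option linter.dupNamespace false

/-- **No coordinate moat between parallel time axes.**  Two Poincaré motions `(Λ, c)`, `(Λ', c')`
with the same orthochronous time axis `Λ∂₀ = Λ'∂₀`, and a clause separating, at every point `y` that
is late for the flat clock `y⁰` and for the first hole clock, the first hole's tube `{r ≤ F ∘ t}` from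
the second hole by the radius `G ∘ t'`, with `F ≥ 0` eventually and `G → ∞`: contradiction (witness:
late points of the first hole's axis, whose second-frame radius is constant). -/
theorem false_of_parallel_timeAxes_of_moat (Λ Λ' : lorentzGroup) (c c' : E4) (M a M' a' T : ℝ)
    (F G : ℝ → ℝ)
    (horth : 0 < ((Λ : E4 ≃L[ℝ] E4) (E4.basisVector 0)) 0)
    (hpar : (Λ : E4 ≃L[ℝ] E4) (E4.basisVector 0) = (Λ' : E4 ≃L[ℝ] E4) (E4.basisVector 0))
    (hF : ∀ᶠ s in atTop, 0 ≤ F s) (hG : Tendsto G atTop atTop)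
    (hmoat : ∀ y : E4, T ≤ y 0 → T ≤ (boostedKerrBackground Λ c M a).time y →
      (boostedKerrBackground Λ c M a).radius y ≤ F ((boostedKerrBackground Λ c M a).time y) →
      G ((boostedKerrBackground Λ' c' M' a').time y) <
        (boostedKerrBackground Λ' c' M' a').radius y) :
    False := by
  set w : E4 := ((Λ' : E4 ≃L[ℝ] E4).symm (c - c')) with hw
  set K : ℝ := Kerr.radius a' w with hK
  -- the four lateness / size conditions on the axis parameter `s`, all eventually true
  have h2 : ∀ᶠ s in atTop, K ≤ G (s + w 0) :=
    (tendsto_atTop_add_const_right atTop (w 0) tendsto_id).eventually (hG.eventually_ge_atTop K)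
  have h3 : ∀ᶠ s in atTop, T ≤ s := eventually_ge_atTop T
  have h4 : ∀ᶠ s in atTop, T ≤ s * ((Λ : E4 ≃L[ℝ] E4) (E4.basisVector 0)) 0 + c 0 :=
    (tendsto_atTop_add_const_right atTop (c 0) (Tendsto.atTop_mul_const horth tendsto_id))
      |>.eventually_ge_atTop T
  obtain ⟨s, hs1, hs2, hs3, hs4⟩ := (hF.and (h2.and (h3.and h4))).exists
  set y : E4 := s • (Λ : E4 ≃L[ℝ] E4) (E4.basisVector 0) + c with hy
  have hy0 : y 0 = s * ((Λ : E4 ≃L[ℝ] E4) (E4.basisVector 0)) 0 + c 0 := by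
    simp only [hy, PiLp.add_apply, PiLp.smul_apply, smul_eq_mul]
  have hP : poincareInv Λ c y = s • E4.basisVector 0 := by
    simp only [poincareInv, hy, add_sub_cancel_right, map_smul,
      ContinuousLinearEquiv.symm_apply_apply]
  have hP' : poincareInv Λ' c' y = s • E4.basisVector 0 + w := by
    have h1 : y - c' = s • (Λ : E4 ≃L[ℝ] E4) (E4.basisVector 0) + (c - c') := by rw [hy]; abel
    simp only [poincareInv, h1, map_add, map_smul]
    rw [hpar, ContinuousLinearEquiv.symm_apply_apply]
  have ht : (boostedKerrBackground Λ c M a).time y = s := by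
    show (poincareInv Λ c y) 0 = s
    rw [hP]
    simp
  have hr : (boostedKerrBackground Λ c M a).radius y = 0 := by
    show Kerr.radius a (poincareInv Λ c y) = 0
    rw [hP]
    exact kerr_radius_smul_basisVector_zero _ _
  have ht' : (boostedKerrBackground Λ' c' M' a').time y = s + w 0 := by
    show (poincareInv Λ' c' y) 0 = s + w 0
    rw [hP']
    simp
  have hr' : (boostedKerrBackground Λ' c' M' a').radius y = K := by
    show Kerr.radius a' (poincareInv Λ' c' y) = K
    rw [hP', kerr_radius_add_smul_basisVector_zero]
  have hlt := hmoat y (by rw [hy0]; exact hs4) (by rw [ht]; exact hs3)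
    (by rw [hr, ht]; exact hs1)
  rw [ht', hr'] at hlt
  linarith

/-- **(A9) + (A10) are incompatible with parallel labels** — the clause shape of `NeckAtlas` in the
lines `two-cap-focusing-ledger` / `bargmann-small-late-exterior` (any additive margin `m`, there
`m = 2`; certified radii of BOTH holes exhausting every radius; flat-late guard `τ₁ ≤ y⁰`). -/
theorem false_of_parallel_labels_of_coordinateDisjoint (Λ Λ' : lorentzGroup) (c c' : E4)
    (M a M' a' τ₁ m : ℝ) (Rg Rg' : ℝ → ℝ)
    (horth : 0 < ((Λ : E4 ≃L[ℝ] E4) (E4.basisVector 0)) 0)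
    (hpar : (Λ : E4 ≃L[ℝ] E4) (E4.basisVector 0) = (Λ' : E4 ≃L[ℝ] E4) (E4.basisVector 0))
    (hA9 : Tendsto Rg atTop atTop) (hA9' : Tendsto Rg' atTop atTop)
    (hA10 : ∀ y : E4, τ₁ ≤ y 0 →
      (boostedKerrBackground Λ c M a).radius y ≤ Rg ((boostedKerrBackground Λ c M a).time y) + m →
      Rg' ((boostedKerrBackground Λ' c' M' a').time y) + m <
        (boostedKerrBackground Λ' c' M' a').radius y) :
    False :=
  false_of_parallel_timeAxes_of_moat Λ Λ' c c' M a M' a' τ₁ (fun s ↦ Rg s + m) (fun s ↦ Rg' s + m)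
    horth hpar
    ((hA9.eventually_ge_atTop (-m)).mono fun _ hs ↦ by linarith)
    (tendsto_atTop_add_const_right atTop m hA9')
    (fun y hy _ hr ↦ hA10 y hy hr)

/-- **`necks_far` is incompatible with parallel rest frames** — the clause shape of
`NeckShape.necks_far` in the line `order-zero-induction-zone` (multiplicative widths `b·W`, `b'·W'`,
`0 ≤ b`, `0 < b'`, hole-late guard `τ₁ ≤ t y`; `W ≥ 0` eventually, `W' → ∞`). -/
theorem false_of_parallel_timeAxes_of_necksFar (Λ Λ' : lorentzGroup) (c c' : E4)
    (M a M' a' τ₁ b b' : ℝ) (W W' : ℝ → ℝ) (hb : 0 ≤ b) (hb' : 0 < b')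
    (horth : 0 < ((Λ : E4 ≃L[ℝ] E4) (E4.basisVector 0)) 0)
    (hpar : (Λ : E4 ≃L[ℝ] E4) (E4.basisVector 0) = (Λ' : E4 ≃L[ℝ] E4) (E4.basisVector 0))
    (hW : ∀ᶠ s in atTop, 0 ≤ W s) (hW' : Tendsto W' atTop atTop)
    (hfar : ∀ y : E4, τ₁ ≤ (boostedKerrBackground Λ c M a).time y →
      (boostedKerrBackground Λ c M a).radius y ≤ b * W ((boostedKerrBackground Λ c M a).time y) →
      b' * W' ((boostedKerrBackground Λ' c' M' a').time y) <
        (boostedKerrBackground Λ' c' M' a').radius y) :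
    False :=
  false_of_parallel_timeAxes_of_moat Λ Λ' c c' M a M' a' τ₁ (fun s ↦ b * W s) (fun s ↦ b' * W' s)
    horth hpar (hW.mono fun _ hs ↦ mul_nonneg hb hs) (hW'.const_mul_atTop hb')
    (fun y _ ht hr ↦ hfar y ht hr)

/-- **No coordinate moat between two holes of a final-state decomposition with parallel,
orthochronous labels** (`FinalStateDecomposition` form of `false_of_parallel_timeAxes_of_moat`;
`j = j'` is allowed and equally contradictory). -/
theorem false_of_parallel_labels_of_moat {𝓢 : Spacetime.{0} 4} {O : Set 𝓢.carrier} {k : ℕ}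
    (d : FinalStateDecomposition 𝓢 O k) {j j' : Fin d.N} (T : ℝ) (F G : ℝ → ℝ)
    (horth : 0 < (((d.motion j).1 : E4 ≃L[ℝ] E4) (E4.basisVector 0)) 0)
    (hpar : ((d.motion j).1 : E4 ≃L[ℝ] E4) (E4.basisVector 0) =
      ((d.motion j').1 : E4 ≃L[ℝ] E4) (E4.basisVector 0))
    (hF : ∀ᶠ s in atTop, 0 ≤ F s) (hG : Tendsto G atTop atTop)
    (hmoat : ∀ y : E4, T ≤ y 0 → T ≤ (d.background j).time y →
      (d.background j).radius y ≤ F ((d.background j).time y) →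
      G ((d.background j').time y) < (d.background j').radius y) :
    False :=
  false_of_parallel_timeAxes_of_moat (d.motion j).1 (d.motion j').1 (d.motion j).2 (d.motion j').2
    (d.mass j) (d.spin j) (d.mass j') (d.spin j') T F G horth hpar hF hG hmoat

/-- **The `NeckAtlas` clauses (A9)+(A10) of the lines `two-cap-focusing-ledger` and
`bargmann-small-late-exterior` fail for an input with two parallel orthochronous labels** (their exact
shape over `d.background`, margin `2`). -/
theorem false_of_parallel_labels_of_neckAtlasMoat {𝓢 : Spacetime.{0} 4} {O : Set 𝓢.carrier}
    {k : ℕ} (d : FinalStateDecomposition 𝓢 O k) (Rg : Fin d.N → ℝ → ℝ) (τ₁ : ℝ) {j j' : Fin d.N}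
    (horth : 0 < (((d.motion j).1 : E4 ≃L[ℝ] E4) (E4.basisVector 0)) 0)
    (hpar : ((d.motion j).1 : E4 ≃L[ℝ] E4) (E4.basisVector 0) =
      ((d.motion j').1 : E4 ≃L[ℝ] E4) (E4.basisVector 0))
    (hA9 : ∀ i, Tendsto (Rg i) atTop atTop)
    (hA10 : ∀ i i' (y : E4), i ≠ i' → τ₁ ≤ y 0 →
      (d.background i).radius y ≤ Rg i ((d.background i).time y) + 2 →
      Rg i' ((d.background i').time y) + 2 < (d.background i').radius y)
    (hne : j ≠ j') : False :=
  false_of_parallel_labels_of_coordinateDisjoint (d.motion j).1 (d.motion j').1 (d.motion j).2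
    (d.motion j').2 (d.mass j) (d.spin j) (d.mass j') (d.spin j') τ₁ 2 (Rg j) (Rg j') horth hpar
    (hA9 j) (hA9 j') (fun y hy hr ↦ hA10 j j' y hne hy hr)

end Summit.FinalStateConjecture.FinalStateConjecture.Theorems.NecksCertify.Negative

end
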